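import Mathlib
import HarnessLib
import HarnessLib.Audit
import Summits.CriticalPhenomena.Statement
import Literature.Probability.RandomPlanarGeometry.RestrictionHulls
import Summits.CriticalPhenomena.SAWScalingLimit.Theorems.SAWLoopFugacityFlowAvoidanceDeterminesLaw
import HarnessLib.Audit.Status.Attr

/-!
Route: SAWFrontierHomotopy

# Route SAWFrontierHomotopy — Drain the lakes: from the RW-excursion frontier (κ = 8/3 read off
Brownian motion) to the SAW along a one-sided-restriction-exact tilt homotopy, endpoint pinned by
symmetry

It suffices to show X = (E0) ∧ (S) ∧ (T), realising idea card drain-the-lakes-one-sided-homotopy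
("the SAW is the random walk's coastline with the inland lakes drained"):
 (E0) OneSidedPowerLaw — the s = 0 end of the card's homotopy: ONE exponent α such that for every
Dobrushin domain (D; a, b), every endpoint approximation
(Literature.Probability.RandomPlanarGeometry.SAW.IsEndpointApprox) and every hull subdomain D' of D
(D' ⊆ D with the same marked points and a, b ∉ closure (D ∖ D') —
Literature.Probability.RandomPlanarGeometry.MarkedDomain.IsHullSubdomain written out) whose
pulled-back hull A = closure (ℍ ∖ φ⁻¹D') under a chordal uniformizer φ
(Literature.Probability.RandomPlanarGeometry.ConformalEquiv.pullbackHull written out; both inlined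
since rev 1 so that the route file imports only RestrictionHulls) is ONE-SIDED
(Literature.Probability.RandomPlanarGeometry.IsPlusHull or IsMinusHull: attached to a single
boundary arc), the critical SAW probability Literature.Probability.RandomPlanarGeometry.SAW.law[γ ⊆
cl D'] tends, along δ → 0⁺, to Φ'_A(0)^α
(Literature.Probability.RandomPlanarGeometry.HasRestrictionDeriv);
 (S) SimpleSubseqLimits — subsequential limits of the SAW laws are carried by simple chords meeting
∂D only at a, b;
 (T) EventualTight — eventual tightness of the pushed-forward SAW laws (the shared item
stmt-CriticalPhenomena-1372: ∃ δ₀ > 0 with {law_δ ∘ curve⁻¹ : δ ∈ (0, δ₀]} a tight set — the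
repaired form of the refuted all-δ Tight; it implies the IsTightAlongMesh form
stmt-CriticalPhenomena-1881).
The MECHANISM by which the line means to deliver (E0) is filed as cruxes of its own: the exact
lattice family P^(s) ∝ x(s)^|γ| B(γ)^s (B = frontier weight of the random-walk excursion,
left-measurable ⇒ one-sided restriction EXACT for every s; OneSidedContinuation, informal until its
definitions land), anchored at s = 1 where the one-sided avoidance functional is a random-walk
Green-function ratio converging to Φ'_A(0) (ExcursionKernelRatioLimit, typed) and the frontier
itself converges to SLE(8/3; 2/3) (FrontierAnchor, informal). The closing is symmetric and rests on
PROVED cone facts: one-sided power law on both sides + exact lattice restriction ⇒ two-sided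
Φ'_A(0)^α for every A ∈ 𝒬* = 𝒬₊ ⊔ 𝒬₋ ⇒
Literature.Probability.RandomPlanarGeometry.LawlerSchrammWerner2003_holds forces α = 5/8 and chordal
SLE_(8/3) (OneSidedClosing), then Prokhorov (TightIdentificationGlue).
Lean: `OneSidedPowerLaw ∧ SimpleSubseqLimits ∧ EventualTight`

## Assembly
Pure logic once the items stand: OneSidedClosing turns (E0) + (S) into SubseqIdentification, and
TightIdentificationGlue turns SubseqIdentification + (T) into the conjunct. The DECIDING THEOREM
(D-0027 §2.1) is `closes : OneSidedPowerLaw → SimpleSubseqLimits → OneSidedClosing → EventualTight →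
TightIdentificationGlue → SAWScalingLimit := fun h₁ h₂ h₃ h₄ h₅ => h₅ (h₃ h₁ h₂) h₄` (certified rev
1); the optional Assembly item `EventualTight → OneSidedPowerLaw → SimpleSubseqLimits →
OneSidedClosing → TightIdentificationGlue → SAWScalingLimit` is the same logic (`fun hT h₁ h₂ hC hG
=> hG (hC h₁ h₂) hT`, planner Sketch.lean rc 0). All mathematics sits in the antecedent items; the
continuum identification inside OneSidedClosing rests on PROVED tree facts
(LawlerSchrammWerner2003_holds, IsSLELaw.hullRestriction_eightThirds_holds,
IsRightRestrictionMeasure.unique, convergesInLawToSLE_of_isTightAlongMesh, IsSLECurve.map_eq_holds),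
and since rev 1 the route file imports only
Literature.Probability.RandomPlanarGeometry.RestrictionHulls besides the Statement, so no
route-specific unproved named fact is in the import cone. The mechanism cruxes OneSidedContinuation
(rank 3) and FrontierAnchor (rank 5) are filed informally (their signatures wait for the definition
requests) and feed OneSidedPowerLaw through the two-layer plan.

Rationale: WHY THIS LINE. Lawler–Schramm–Werner (arXiv:math/0209343 §8, Cor. 8.5; Werner arXiv:math/0307353)
classify simple curves with ONE-sided conformal restriction as SLE(8/3; ρ) — all with κ = 8/3 — and
the right boundary of the Brownian excursion is the member ρ = 2/3 (exponent ᾱ = 1; tree: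
Literature.Probability.RandomPlanarGeometry.sleKappaRhoExponent, IsRightRestrictionMeasure,
SLEKappaRho.isRightRestrictionMeasure_fill), while chordal SLE_(8/3) is the only member symmetric
under left–right reflection (ρ = 0, ᾱ = 5/8). The card turns this into a lattice programme on δℤ²:
tilt the RW-excursion right-frontier law by B(γ)^(s−1) (switch off the left bubbles) and re-tune the
fugacity; B depends only on the region LEFT of γ, so one-sided restriction is an identity at every
s, the s = 1 end is solved by random-walk potential theory (κ = 8/3 enters through the isotropic
embedded SRW — conformal input with no discrete-holomorphic observable), and the s = 0 end is
Literature.Probability.RandomPlanarGeometry.SAW.law, whose exponent is OUTPUT of symmetry + the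
PROVED Literature.Probability.RandomPlanarGeometry.LawlerSchrammWerner2003_holds, never computed.
Imported areas: conformal restriction / SLE(κ,ρ) theory (continuum, largely vendored and proved in
the tree), discrete potential theory of random-walk excursions (Kozdron arXiv:math/0506337,
Kozdron–Lawler arXiv:math/0501189, Chelkak arXiv:1212.6205) for the anchor, Gibbs-tilt continuation
in a coupling (the genre of Kozdron–Lawler's λ-SAW, arXiv:math/0605159 §6, but inside ONE
universality class: κ fixed, laws locally mutually absolutely continuous). What no prior route does:
SAWConfRestriction / SAWRestrictionRigidity need conformal covariance or a rigidity theorem for the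
SAW limit directly; SAWParafermion / SAWHexUniversality need an observable or a second lattice; here
conformal invariance is imported at the Brownian end and only a scalar exponent α(s) has to be
followed along an exact one-parameter family; the negatives index (all-δ Tight,
stmt-CriticalPhenomena-0772) is respected by using eventual tightness only.

RANKED CRUXES. #2 OneSidedPowerLaw (crux) — (card D1 at s = 0 — the load-bearing endpoint; since rev
1 stated with IsHullSubdomain and pullbackHull written out by their definitions, definitionally
equal to the rev-0 item stmt-CriticalPhenomena-4534) there is one exponent α : ℝ such that for every
Dobrushin domain D, endpoint approximation (a_δ, b_δ), hull subdomain D' of D, chordal uniformizer φ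
of D with pulled-back hull A = closure (ℍ ∖ φ⁻¹D') a plus- OR minus-hull, and restriction data (Φ_A,
d = Φ'_A(0)), the pushed-forward critical SAW law gives the event range ⊆ closure D' a mass tending
to d^α as δ → 0⁺ (full filter). Conjecturally α = 5/8 (LSW04 restriction prediction; Kennedy's
half-plane simulations); the route never uses the value. Minus-hulls follow from plus-hulls by exact
SAW reversal, so the mechanism only has to deliver the plus side. [difficulty: open-problem] (why it
might fail: It IS conformal invariance of SAW hull-avoidance in pure-power form, typed for ALL
endpoint approximations and rough Jordan D (boundary lattice factors must cancel because D' = D near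
a, b); even value-free full-filter existence of the limit is open (cf.
stmt-CriticalPhenomena-1369).) [LawlerSchrammWerner2004SAW, LawlerSchrammWerner2003Restriction,
arXiv:math/0112246, arXiv:math/0207231, KennedyLawler2013]
#4 ExcursionKernelRatioLimit (crux) — (card D2 at the level of avoidance probabilities — the ANCHOR
functional, s = 1 end; since rev 1 with the hull vocabulary written out, definitionally equal to the
rev-0 item stmt-CriticalPhenomena-4535) for every Dobrushin domain D, endpoint approximation, hull
subdomain D' (two-sided allowed), chordal uniformizer φ and restriction data (Φ_A, d = Φ'_A(0)) of A
= closure (ℍ ∖ φ⁻¹D'): the random-walk ratio Σ_(ω : a_δ → b_δ in D_δ, polyline ⊆ cl D') 4^(−|ω|) /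
Σ_(ω : a_δ → b_δ in D_δ) 4^(−|ω|) — the probability that the simple-random-walk excursion from a_δ
to b_δ in Ω_δ stays in cl D', a ratio of killed Green functions — tends to d as δ → 0⁺. This is
Brownian-excursion restriction with exponent 1 (in tree: BrownianExcursionRestriction) made a
lattice limit theorem; κ = 8/3 enters the line here and only here, through the isotropic embedded
SRW. [difficulty: L] (why it might fail: a_δ, b_δ may sit at microscopic depth in δ-scale fjords of
a rough Jordan boundary where the local escape profile does not converge; the ratio must forget it:
discrete boundary Harnack WITH convergence, uniform over arbitrary discrete Jordan domains (in
print: arc-to-arc, or up to constants).) [arXiv:math/0506337, arXiv:math/0501189, arXiv:1212.6205,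
LawlerSchrammWerner2003Restriction]
#6 SimpleSubseqLimits (crux) — (shared verbatim with route SAWLoopFugacityFlow,
stmt-CriticalPhenomena-4982, since rev 1; the earlier curried IsSubseqLimitLaw form
stmt-CriticalPhenomena-4536 was proved equivalent by the route-review refuter and retired as a
duplicate) for every Dobrushin domain (D; a, b), endpoint approximation, sequence s_n → 0⁺ and
probability measure ν on CurveClass ℂ that is the weak limit of the pushed-forward critical SAW laws
along s_n, ν-a.e. curve class is SIMPLE, runs from a to b inside cl D and meets ∂D only in {a, b} —
the class on which LSW's theorem and the symmetric closing operate (K simple, K ∩ ℝ = {0}); exactly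
the carrier clause of AvoidanceDeterminesLaw. Shared need of every restriction-based identification;
the card's D3 tightness/simplicity half. [difficulty: L] (why it might fail: Weak limits of simple
polylines need not be simple (CurveClass.simple is not closed): needs δ-uniform
no-macroscopic-self-touching and no-boundary-crawling bounds for x_c-SAW under EVERY endpoint
approximation; only sub-ballisticity (arXiv:1205.0401) is in print.) [LawlerSchrammWerner2004SAW,
DuminilCopinHammond2013, KennedyLawler2013, stmt-CriticalPhenomena-4982,
Summits/CriticalPhenomena/SAWScalingLimit/Ideas/brownian-domination-simple-limits.md]
#9 OneSidedClosing (support) — the SYMMETRIC CLOSING (card D3, continuum + limit bookkeeping):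
OneSidedPowerLaw → SimpleSubseqLimits → SubseqIdentification. Sketch: (i) every A ∈ 𝒬* is a disjoint
union A₊ ⊔ A₋ of a plus- and a minus-hull (ℍ ∖ A simply connected forces each component of A to
touch ℝ on one side of 0), and Φ_A = Φ_(Φ_A₊(A₋)) ∘ Φ_A₊; (ii) exact lattice restriction of the
x_c-SAW (LSW04 §3.4.5), applied with ε-enlarged/shrunk hulls (sandwich; continuity of A ↦ Φ'_A(0),
tree HullExhaustion/HullKernelLimit) and OneSidedPowerLaw in the intermediate domain D ∖ A₊, gives
lim_δ P_δ[γ ⊆ cl D''] = Φ'_A₊(0)^α · Φ'_(Φ_A₊(A₋))(0)^α = Φ'_A(0)^α for EVERY hull subdomain D'';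
(iii) portmanteau (upper bound on the closed event, lower bound through enlarged hulls) transfers
these values to any subsequential limit μ, simple by SimpleSubseqLimits; (iv) by
AvoidanceDeterminesLaw the conformal images of μ form a well-defined chordal, conformally covariant
family with hull restriction (the Φ' cocycle) carried by simple curves, so the PROVED
Literature.Probability.RandomPlanarGeometry.LawlerSchrammWerner2003_holds gives IsSLELaw (8/3) D μ —
α = 5/8 is output. No conformal covariance of the SAW is assumed anywhere: it is read off the
explicit one-sided functional. [deps: OneSidedPowerLaw, SimpleSubseqLimits, AvoidanceDeterminesLaw,
SubseqIdentification] [difficulty: L] (why it might fail: Only bookkeeping, but real: the lattice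
restriction identity must be run against the largest-component / closure conventions of
discreteDomainGraph (sandwich needs IsEndpointApprox in perturbed subdomains), and the
Jordan-complement hulls must generate the avoidance π-system.) [LawlerSchrammWerner2003Restriction,
LawlerSchrammWerner2004SAW,
Literature.Probability.RandomPlanarGeometry.LawlerSchrammWerner2003_holds,
Literature.Probability.RandomPlanarGeometry.IsSLELaw.hullRestriction_eightThirds_holds]
#9 AvoidanceDeterminesLaw (support) — (shared verbatim with route SAWRestrictionRigidity,
stmt-CriticalPhenomena-1373) two probability measures on CurveClass ℂ carried by simple chords of
(D; a, b) meeting ∂D only at a, b that give the same mass to {range ⊆ closure D'} for every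
Dobrushin D' ⊆ D with the same marked points agreeing with D near a and b are equal (π-system of
hull complements; a simple chord is determined by its range). Used in step (iv) of OneSidedClosing
(well-definedness and covariance of the limit family). [difficulty: provable-now]
[LawlerSchrammWerner2003Restriction, AizenmanBurchard1999]
#9 SubseqIdentification (support) — (shared verbatim with routes SAWParafermion / SAWLeftRightFKG,
stmt-CriticalPhenomena-0783) every subsequential weak limit of the critical SAW laws in (D; a, b) is
the chordal SLE_(8/3) law (IsSLELaw (8/3) D μ). In THIS route it is the output node of
OneSidedClosing, filed so that a proof by any sibling route moots the closing and vice versa.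
[difficulty: open-problem] [LawlerSchrammWerner2004SAW, LawlerSchrammWerner2003Restriction,
DuminilCopinSmirnov2012]
#9 EventualTight (support) — (shared verbatim with routes SAWRenewalTightness /
SAWRestrictionRigidity / SAWLoopFugacityFlow …, stmt-CriticalPhenomena-1372; the repaired, eventual
form of the refuted all-δ stmt-CriticalPhenomena-0772; attached rev 1 — chosen over the
IsTightAlongMesh form stmt-CriticalPhenomena-1881 on the route-review refuter's advice so that the
shared glue keeps ONE referent; 1372 ⇒ 1881 in a few lines) for every Dobrushin domain and endpoint
approximation there is δ₀ > 0 such that the pushed-forward critical SAW laws {(SAW.law D δ a_δ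
b_δ).map curve : δ ∈ (0, δ₀]} form a tight set (MeasureTheory.IsTightMeasureSet). Card D3's
tightness half; staffed through the tightness routes (SAWLeftRightFKG, SAWRenewalTightness,
constant-loss / Kesten-renewal cards). [difficulty: open-problem] [KemppainenSmirnov2017,
AizenmanBurchardDuke1999, DuminilCopinHammond2013]
#9 TightIdentificationGlue (support) — the common tail of the SAW routes (re-materialised by the
route-repair seat): SubseqIdentification → (T) → SAWScalingLimit with (T) = EventualTight written
out verbatim (support items render in item-id order, so this def precedes EventualTight in the file;
`closes` feeds it `(h₄ : EventualTight)` definitionally). Proof plan: for each (D, a, b) with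
IsEndpointApprox the laws SAW.law are probability measures for all small δ (reachability ⇒ weight
univ ≠ 0; finitely many SAWs in bounded Ω_δ ⇒ < ∞), so replace them by a probability-valued family
with the same germ at 0⁺ (ConvergesInLawToSLE and the subsequential-limit hypotheses only see the
germ; the PROVED criterion wants [∀ δ, IsProbabilityMeasure] — clamp the family off the germ), get
IsTightAlongMesh from the ∃δ₀ tight-set form, then apply the PROVED
Literature.Probability.RandomPlanarGeometry.convergesInLawToSLE_of_isTightAlongMesh with huniq :=
IsSLECurve.map_eq_holds, hY := SAW.aemeasurable_curve, and unfold SAWScalingLimit. [difficulty: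
provable-now] [Literature.Probability.RandomPlanarGeometry.convergesInLawToSLE_of_isTightAlongMesh,
Literature.Probability.RandomPlanarGeometry.IsSLECurve.map_eq_holds, BillingsleyCPM1999]

TWO-LAYER PLAN. Foreseen glued splits (nothing filed now): OneSidedPowerLaw ⇐
OneSidedContinuationAtZero (plus-hulls, s = 0 instance of rank-3 OneSidedContinuation) →
ReversalSymmetry (law (D; b, a) = reverse_* law (D; a, b), exact; plus-hulls of the swapped domain =
minus-hulls) → OneSidedPowerLaw. OneSidedContinuation ⇐ PerturbativeWindow (s ∈ (1 − ε, 1]: the tilt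
B^(s−1) as a multiplicative functional of the converging frontier, base FrontierAnchor +
ExcursionKernelRatioLimit) → AnalyticContinuation (δ-uniform analyticity / zero-freeness of s ↦
(x(s), p_s) on a complex neighbourhood of [0, 1], Vitali) → OneSidedContinuation. OneSidedClosing ⇐
TwoSidedFromOneSided (lattice sandwich + the 𝒬* = 𝒬₊ ⊔ 𝒬₋ cocycle, steps (i)–(ii)) →
RestrictionFormulaIdentifiesSLE (steps (iii)–(iv): portmanteau, AvoidanceDeterminesLaw,
LawlerSchrammWerner2003_holds) → OneSidedClosing.

KILL CRITERIA. ¬OneSidedPowerLaw in the form "the one-sided limits exist but are not a common pure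
power of Φ'_A(0)" (certified transfer-matrix / exact enumeration in a lattice domain, or a
Kennedy-type simulation beyond error bars) closes the route refuted:OneSidedPowerLaw — and with it
conformal invariance of any SAW limit, i.e. effectively the conjunct. ¬ExcursionKernelRatioLimit for
some admissible endpoint approximation means microscopic boundary data survive in excursion ratios;
then the 'all IsEndpointApprox' quantifier of the conjunct is suspect for the SAW as well (pivot:
restate both over Carathéodory-regular approximations; not a route-only issue). ¬SimpleSubseqLimits
kills every restriction-based identification (no pivot inside LSW's class: P_α with α > 5/8 are not
curves). Refutation of the MECHANISM — OneSidedContinuation false at some s ∈ (0, 1) (tilted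
one-sided avoidance not pure-power, or x(s) ill-defined / domain-dependent) — retires the homotopy;
the typed skeleton then merely restates a one-sided SAWConfRestriction and the route is closed
superseded (by SAWRestrictionRigidity / SAWConfRestriction) unless FrontierAnchor has independent
traction. EventualTight / SubseqIdentification proved elsewhere moot the corresponding items, not
the line.

NOT DECOMPOSED YET. The interior of OneSidedContinuation (perturbative window; analytic
continuation; the critical curve x(s) and its domain-independence via half-plane subadditivity);
FrontierAnchor's tightness near the pinned endpoints (random-walk disconnection / half-plane
exponents uniform in rough Jordan domains) and the no-artefact property of the pinch-filling
convention at mesoscopic scales; the reversal lemma and the swapped DobrushinDomain; the four steps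
of OneSidedClosing; the probability-measure-eventually bookkeeping of TightIdentificationGlue;
measurability of CurveClass.simple. All are layer-2 children or prover-side lemmas (--supports), per
D-0019.

CHEAPEST FALSIFIER. Lookup run this session: Kennedy arXiv:math/0112246 (read, pp. 2–3) found
P[half-plane SAW avoids A] = Φ'_A(0)^(5/8) for the ONE-SIDED half-discs A_a at 1 (Φ' = 1 − a²) and
slits L_a (Φ' = (1 + a²)^(−1/2)) to ~0.1%: the half-plane form of OneSidedPowerLaw with α = 5/8
PASSED. Cheapest new checks: (1) α-free ratio test in a bounded ℤ² domain — transfer matrix / exact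
enumeration of x_c-SAWs corner-to-corner in an L × M rectangle (L, M ≤ 10) with two one-sided square
bumps A₁, A₂ on the same side, comparing log P[avoid A₁]/log P[avoid A₂] with log Φ'_A₁(0)/log
Φ'_A₂(0) of the rectangle (Schwarz–Christoffel); a trend away from the conformal ratio as L grows
kills (E0). (2) Mechanism: sample 10⁴ face-walk excursions in a half-disc at δ = 1/200, extract
pinch-filled right frontiers, test one-sided half-disc avoidance against 1 − a² (exponent 1; failure
= the frontier convention breaks the collar identity), then reweight by B^(s−1) (inner resampling)
at s = 0.9 and test the pure-power form with fitted α(s). Not run in this one-shot unit; refuters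
should run (1) first.

NUMBERS. ᾱ(ρ) = (ρ + 2)(3ρ + 10)/32 (tree: sleKappaRhoExponent; LSW03 Thm 8.4): ρ = 2/3 ↦ 1
(Brownian-excursion right boundary = SLE(8/3, 2/3), LSW03 Cor. 8.5, arXiv:math/0209343 p. 20 of the
held text), ρ = 0 ↦ 5/8 (chordal SLE_(8/3)); inverse ρ(α) = (−8 + 2√(24α + 1))/3 (tree:
sleRhoOfExponent). Restriction data used by Kennedy: Φ'_(A_a)(0) = 1 − a², Φ'_(L_a)(0) = (1 +
a²)^(−1/2), law of the closest approach P(X ≤ t) = 1 − (1 − t²)^(5/8) (arXiv:math/0112246 p. 3).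
μ(ℤ²) ∈ [2.6, 2.7] (tree fact LawlerSchrammWerner2004SAW_connectiveConstant_bounds), x_c = 1/μ ≈
0.379; x(1) = 1/4 (SRW step weight; B already carries 4^|γ|). Brownian-excursion restriction
exponent 1 (two-sided), SLE_(8/3) exponent 5/8 (Thm 6.1, tree: sle_restriction_eightThirds_holds).

DEFINITION REQUESTS. Filed right after open (ledger workitem add --kind definition …, --for the
informal cruxes): (D-a) RightFrontierSAW — for a nearest-neighbour walk ω on the FACES of Ω_δ ⊆ δℤ²
(dual sites) from the face at a_δ to the face at b_δ: U(ω) = union of the closed faces visited,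
U*(ω) = its checkerboard-pinch filling (at a vertex where exactly two diagonal faces of U meet, add
the two missing faces; iterate to stability — all added faces lie in the same complementary region),
whose boundary components are SIMPLE ℤ²-edge circuits; rightFrontier ω = the arc of ∂U*(ω) from a_δ
to b_δ facing the right boundary arc, a DomainSAW. Required API: left-measurability (U*(ω) lies in
the closed region left of the frontier), achievability (every DomainSAW γ is the frontier of the
walk sweeping the left face-collar of γ, so B > 0 on all SAWs and the s = 0 end is exactly SAW.law),
and the collar identity {ω ⊆ cl D'} ⊆ {frontier ⊆ cl D'} ⊆ {ω ⊆ cl (D')^(+2δ)} for hull subdomains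
attached to the right arc (on ℤ² the identity holds up to a 2δ collar, not exactly — found this
session; on the hexagonal/triangular pair it is exact). (D-b) FrontierTiltedSAWLaw — B(γ) := 4^|γ| ·
Σ_(ω : rightFrontier ω = γ) 4^(−|ω|) and P^(s)_(Ω,δ,a,b)(γ) ∝ x^|γ| B(γ)^s on DomainSAW, together
with the critical curve x(s) (largest x with finite half-plane bridge-type generating function; x(1)
= 1/4, x(0) = x_c; existence/uniqueness is part of the request). (D-c) SLEKappaRhoCurveLaw — the law
on CurveClass ℂ of the SLE(κ; ρ) trace in a Dobrushin domain with force point at a⁺, from the tree's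
IsSLEKappaRhoPair + Loewner trace + chordal uniformizer (to give FrontierAnchor a signature; target
SLE(8/3; 2/3)). No cite facts requested: the continuum inputs (LSW03 §8, Thm 6.1, p. 5 result 2) are
already vendored, mostly PROVED.

Novelty: Searches (2026-08-15): `lit search --hybrid "random walk excursion outer boundary frontier scaling
limit SLE(8/3) rho one-sided restriction"` (12 held docs; only Lawler 2005 book relevant,
continuum); `lit search --source crossref` same words (14 rows, none relevant; nearest
doi:10.1007/s10955-018-2176-9 Kennedy's Manhattan-lattice walk → SLE₆ and doi:10.24033/asens.2460
Gwynne–Miller SAW on quadrangulations); `lit search --source zbmath "random walk excursion Poisson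
kernel scaling limit"` → arXiv:math/0506337 (Kozdron 2006, read: Thm 1.1 arc-to-arc),
arXiv:math/0703615; zbMATH → arXiv:math/0501189 (Kozdron–Lawler 2005), arXiv:1212.6205 (Chelkak
2016), arXiv:math/0112246 + arXiv:math/0207231 (Kennedy, read); `lit read arxiv:math/0209343 --grep`
(Cor. 8.5: excursion right boundary = SLE(8/3, 2/3)); `lit vsearch` of the anchor statement (8 docs,
Lawler 2005 only); `lit frontier CriticalPhenomena --since 2020` (30 descendants, none on excursion
frontiers or SAW homotopies; arXiv:2605.04395 is FK-side); `lit galaxy search --star all` attempted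
twice ("outer boundary of the random walk excursion", "boundary of Brownian excursion"): galaxyd
queue saturated > 90 s both times, not charged, not run; OpenAlex / Semantic Scholar / arXiv APIs
returned HTTP 429 this session. Plus the card's own searches and the refuter novelty audit of
2026-08-15 (grade new-combination, LSW03 §8 / Werner 2004 read).
Nearest prior art found: arXiv:math/0209343 (LSW03 §8, Thm 8.4, Cor. 8.5, Thm 6.1: the co  [refs: 10.1007/s10955-018-2176-9, 10.24033/asens.2460, math/0506337, math/0703615, math/0501189, 1212.6205, math/0112246, math/0207231, math/0209343, 2605.04395, math/0307353, math/0605159, doi:10.1007/s10955-018-2176-9, doi:10.24033/asens.2460, arxiv:math/0209343]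

Barriers (technique_class: one-sided-restriction tilt-homotopy random-walk-frontier): - technique_class: one-sided-restriction tilt-homotopy random-walk-frontier
- Literature.Barriers.CriticalPhenomena.NienhuisWeightsExcludeVertexSAW: does not apply — no
loop/vertex weights, no O(n) embedding; the family P^(s) is a Gibbs tilt of the plain x^|γ| SAW
weights by a random-walk functional.
- Literature.Barriers.CriticalPhenomena.ParafermionicHalfCauchyRiemann: does not apply — no
observable and no local linear relation at any s; conformal input is the convergence of random-walk
Green-function ratios (ExcursionKernelRatioLimit), a full (not half) discrete harmonicity.
- Literature.Barriers.CriticalPhenomena.SAWNotKineticallyGrown: evaded — P^(s) is configurational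
for every s (a tilt of path weights), never a consistent kinetically grown family; the s = 1
frontier is a deterministic function of a Markov path but is not itself grown by a local rule, so
the locality ⇒ κ = 6 clause does not bite (one-sided exponent 1 ≠ percolation's).
- Literature.Barriers.CriticalPhenomena.PlanarEdwardsModelDiffusive: evaded — no finite
self-repulsion of the random walk is used; the frontier is self-avoiding by construction and the
tilt B^(s−1) acts on frontiers (SAWs), not on walks, so Varadhan/Lawler §6.4 diffusivity is
irrelevant.
- Literature.Barriers.CriticalPhenomena.SupercriticalSAWSpaceFilling: respected as a guard — x(s)
must be exactly critical at every s (part of OneSidedContinuation, like y_c in the λ-SAW); at s = 0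
it is x_c exactly and nothing is claimed fugacity-robustl

Novelty grade: new-combination — ROUTE REVIEW gen-2 addendum (refuter …-32c464e2-g2-0, 2026-08-15 14:33Z; texts REVIEW_R3.md [gen-0] + REVIEW_G2.md [g2] on stmt-4539). Grade unchanged: new-combination for the frontier-tilt mechanism (LSW03 §8, Werner 04, Kozdron(–Lawler), Kennedy), 'variant' for the typed skeleton (one-sided versio (refuter refuter-rreview-route-CriticalPhenomena--32c464e2-g2-0, 2026-08-15T14:31:56Z; prior: arXiv:math/0209343 §8 Cor 8.5, Thm 8.4, Thm 6.1 (LSW03), arXiv:math/0307353 (Werner, one-sided restriction), arXiv:math/0506337 (Kozdron), arXiv:math/0501189 (Kozdron–Lawler), arXiv:1212.6205 (Chelkak toolbox), arXiv:math/0605159 §6 (Kozdron–Lawler λ-SAW), arXiv:math/0112246 (Kennedy), stmt-CriticalPhenomena-4981/4982 (SAWLoopFugacityFlow), stmt-CriticalPhenomena-1369 (SAWRestrictionRigidity))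

History (route lifecycle, newest last):
- 2026-08-15T16:21:26Z · rev 1: restated OneSidedPowerLaw (stmt-CriticalPhenomena-4534), ExcursionKernelRatioLimit (stmt-CriticalPhenomena-4535), SimpleSubseqLimits (stmt-CriticalPhenomena-4536), TightIdentificationGlue (stmt-CriticalPhenomena-4538), Assembly (stmt-CriticalPhenomena-4539) — route-repair (rbadge g4): (a) EventualTight attached  (planner-rbadge-CriticalPhenomena-SAWFrontierHo-44a8bcf0-g4-0)
- 2026-08-15T16:54:56Z · rev 1: restated TightIdentificationGlue (stmt-CriticalPhenomena-10704) — route-repair (rbadge g4) step 2: list EventualTight (= shared stmt-1372) with decl_name; re-materialise TightIdentificationGlue as SubseqIdentification → (T wri (planner-rbadge-CriticalPhenomena-SAWFrontierHo-44a8bcf0-g4-0)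
- 2026-08-16T02:18:02Z · AUTO-CRUX: 1 conjecture-grade item(s) promoted to crux (OneSidedContinuation) — refuter vetting / tiering apply (operator:999:1362873)
- 2026-08-16T08:10:27Z · rev 3: restated Assembly (stmt-CriticalPhenomena-10705) — route-repair (ground-failed): restate Assembly faithfully as frame statement #1 X → Statement (X = (E0)∧(S)∧(T) curried): OneSidedPowerLaw → SimpleSubseqLimits (planner-rground-CriticalPhenomena-SAWFrontierHo-44a8bcf0-0)

sub-problem: SAWScalingLimit · status: open · opened planner-plancard-CriticalPhenomena-SAWScaling-61aaa9f4-0 2026-08-15T11:34:28Z · rev 3 · ledger route-CriticalPhenomena-SAWFrontierHomotopy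
GENERATED by the gate from the ledger (D-0016/17). Provers cite these decls: `theorem foo : Summit.CriticalPhenomena.SAWScalingLimit.Theses.SAWFrontierHomotopy.<Decl> := …` in Summits/CriticalPhenomena/SAWScalingLimit/Theorems/<Name>.lean.
-/

namespace Summit.CriticalPhenomena.SAWScalingLimit.Theses.SAWFrontierHomotopy

open scoped BigOperators Topology Manifold Classical MeasureTheory ProbabilityTheory Matrix InnerProductSpace ComplexConjugate ContinuousMap
open Filter Set Function TopologicalSpace MeasureTheory

attribute [summit_statement] _root_.SAWScalingLimit

-- earlier OneSidedPowerLaw (stmt-CriticalPhenomena-4534, replaced 2026-08-15T16:21:26Z -> stmt-CriticalPhenomena-10702): retired by None — ∃ α : ℝ, ∀ (D : Literature.Probability.RandomPlanarGeometry.DobrushinDomain) (a b : ℝ → Literature.Probability.LatticeModels.Site 2), Literature.Probability.RandomPlanarGeometry.SAW.IsEndpointApprox D a b → ∀ (D' : Literature.Probability.RandomPlanarGeometry.Dobr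
/-- item stmt-CriticalPhenomena-10702 · crux · rank 2 · open · by planner
why it might fail: It IS conformal invariance of SAW hull-avoidance in pure-power form, typed for ALL endpoint approximations and rough Jordan D (boundary lattice factors must cancel because D' = D near a, b); even value-free full-filter existence of the limit is open (cf. stmt-CriticalPhenomena-1369).
sources: LawlerSchrammWerner2004SAW, LawlerSchrammWerner2003Restriction, arXiv:math/0112246, arXiv:math/0207231, KennedyLawler2013, stmt-CriticalPhenomena-4534
[crux] (card D1 at s = 0 — the load-bearing endpoint; RESTATED 2026-08-15 by the route-repair seat
by DEFINITIONAL UNFOLDING ONLY: `MarkedDomain.IsHullSubdomain D D'` is written out as its five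
clauses (D' ⊆ D, same marked points, a, b ∉ closure (D ∖ D')) and the pulled-back hull
`φ.pullbackHull D'` as `closure (ℍ ∖ {z ∈ ℍ | φ z ∈ D'})`, so that the route file no longer imports
HullSubdomainPullback / ConformalRestrictionProofs and their unproved cone facts; `Iff.rfl` with the
previous stmt-CriticalPhenomena-4534, evidence SketchEquiv.lean) there is one exponent α : ℝ such
that for every Dobrushin domain D, endpoint approximation (a_δ, b_δ), hull subdomain D' of D,
chordal uniformizer φ of D whose pulled-back hull A = closure (ℍ ∖ φ⁻¹D') is a plus- OR minus-hull,
and restriction data (Φ_A, d = Φ'_A(0)), the pushed-forward critical SAW law gives the event range ⊆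
closure D' a mass tending to d^α as δ → 0⁺ (full filter). Conjecturally α = 5/8 (LSW04 restriction
prediction; Kennedy's half-plane simulations); the route never uses the value. Minus-hulls follow
from plus-hulls by exact SAW reversal. Implied (α = 5/8) by SAWLoopFugacityFlow.AvoidanceLimit
(stmt-CriticalPhenomena-4981; ref -/
@[route_item "route-CriticalPhenomena-SAWFrontierHomotopy", crux]
def OneSidedPowerLaw : Prop :=
  ∃ α : ℝ, ∀ (D : Literature.Probability.RandomPlanarGeometry.DobrushinDomain) (a b : ℝ → Literature.Probability.LatticeModels.Site 2), Literature.Probability.RandomPlanarGeometry.SAW.IsEndpointApprox D a b → ∀ (D' : Literature.Probability.RandomPlanarGeometry.DobrushinDomain), (D'.carrier ⊆ D.carrier ∧ D'.pt 0 = D.pt 0 ∧ D'.pt 1 = D.pt 1 ∧ D.pt 0 ∉ closure (D.carrier \ D'.carrier) ∧ D.pt 1 ∉ closure (D.carrier \ D'.carrier)) → ∀ (φ : Literature.Probability.RandomPlanarGeometry.ConformalEquiv UpperHalfPlane.upperHalfPlaneSet D.carrier), D.IsChordalUniformizing φ → (Literature.Probability.RandomPlanarGeometry.IsPlusHull (closure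 (UpperHalfPlane.upperHalfPlaneSet \ {z : ℂ | z ∈ UpperHalfPlane.upperHalfPlaneSet ∧ φ z ∈ D'.carrier})) ∨ Literature.Probability.RandomPlanarGeometry.IsMinusHull (closure (UpperHalfPlane.upperHalfPlaneSet \ {z : ℂ | z ∈ UpperHalfPlane.upperHalfPlaneSet ∧ φ z ∈ D'.carrier}))) → ∀ (Φ : Literature.Probability.RandomPlanarGeometry.ConformalEquiv (UpperHalfPlane.upperHalfPlaneSet \ closure (UpperHalfPlane.upperHalfPlaneSet \ {z : ℂ | z ∈ UpperHalfPlane.upperHalfPlaneSet ∧ φ z ∈ D'.carrier})) UpperHalfPlane.upperHalfPlaneSet) (d : ℝ), Literature.Probability.RandomPlanarGeometry.IsRestrictionMap (closure (UpperHalfPlane.upperHalfPlaneSet \ {z : ℂ | z ∈ UpperHalfPlane.upperHalfPlaneSet ∧ φ z ∈ D'.carrier})) Φ → Literature.Probability.RandomPlanarGeometry.HasRestrictionDeriv (closure (UpperHalfPlane.upperHalfPlaneSet \ {z : ℂ | z ∈ UpperHalfPlane.upperHalfPlaneSet ∧ φ z ∈ D'.carrier})) Φ d → Filter.Tendsto (fun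 δ => ((Literature.Probability.RandomPlanarGeometry.SAW.law D.carrier δ (a δ) (b δ)).map (fun γ => γ.curve)) (Literature.Probability.RandomPlanarGeometry.CurveClass.rangeSubset (closure D'.carrier))) (nhdsWithin 0 (Set.Ioi 0)) (nhds (ENNReal.ofReal (d ^ α)))

-- item stmt-CriticalPhenomena-5105 · crux (kind.auto-crux: conjecture-grade) · rank 3 · open · by planner — informal only, no Lean statement yet:
--   [crux] (card D1 — the MECHANISM of route SAWFrontierHomotopy; informal until definition requests
--   RightFrontierSAW and FrontierTiltedSAWLaw land) Let P^(s)_{Ω,δ}(γ) ∝ x(s)^{|γ|} · B(γ)^s on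
--   SAW.DomainSAW Ω δ a_δ b_δ, s ∈ [0,1], where B(γ) := 4^{|γ|} · (mass Σ 4^{-|ω|} of nearest-neighbour
--   FACE-walks ω of Ω_δ from the face at a_δ to the face at b_δ whose checkerboard-pinch-filled RIGHT
--   FRONTIER is γ) and x(s) is the critical fugacity of the tilted weights (x(1) = 1/4: P^(1) = law of
--   the RW-excursion right frontier; x(0) = x_c: P^(0) = SAW.law exactly, every ℤ²-SAW being an
--   achievable frontier vi

-- earlier ExcursionKernelRatioLimit (stmt-CriticalPhenomena-4535, replaced 2026-08-15T16:21:26Z -> stmt-CriticalPhenomena-10703): retired by None — ∀ (D : Literature.Probability.RandomPlanarGeometry.DobrushinDomain) (a b : ℝ → Literature.Probability.LatticeModels.Site 2), Literature.Probability.RandomPlanarGeometry.SAW.IsEndpointApprox D a b → ∀ (D' : Literature.Probability.RandomPlanarGeometry.Dobr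
/-- item stmt-CriticalPhenomena-10703 · crux · rank 4 · open · by planner
why it might fail: a_δ, b_δ may sit at microscopic depth in δ-scale fjords of a rough Jordan boundary where the local escape profile does not converge; the ratio must forget it: discrete boundary Harnack WITH convergence, uniform over arbitrary discrete Jordan domains (in print: arc-to-arc, or up to constants).
sources: arXiv:math/0506337, arXiv:math/0501189, arXiv:1212.6205, LawlerSchrammWerner2003Restriction, stmt-CriticalPhenomena-4535
[crux] (card D2 — the ANCHOR functional, s = 1 end; RESTATED 2026-08-15 by definitional unfolding of
`IsHullSubdomain` and `pullbackHull` exactly as OneSidedPowerLaw, `Iff.rfl` with the previous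
stmt-CriticalPhenomena-4535, evidence SketchEquiv.lean) for every Dobrushin domain D, endpoint
approximation, hull subdomain D' (two-sided allowed), chordal uniformizer φ and restriction data
(Φ_A, d = Φ'_A(0)) of A = closure (ℍ ∖ φ⁻¹D'): the random-walk ratio Σ_(ω : a_δ → b_δ in D_δ,
polyline ⊆ cl D') 4^(−|ω|) / Σ_(ω : a_δ → b_δ in D_δ) 4^(−|ω|) — the probability that the
simple-random-walk excursion from a_δ to b_δ in Ω_δ stays in cl D', a ratio of killed Green
functions — tends to d as δ → 0⁺. Brownian-excursion restriction with exponent 1 made a lattice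
limit theorem; κ = 8/3 enters the line here and only here, through the isotropic embedded SRW.
[difficulty: L] -/
@[route_item "route-CriticalPhenomena-SAWFrontierHomotopy"]
def ExcursionKernelRatioLimit : Prop :=
  ∀ (D : Literature.Probability.RandomPlanarGeometry.DobrushinDomain) (a b : ℝ → Literature.Probability.LatticeModels.Site 2), Literature.Probability.RandomPlanarGeometry.SAW.IsEndpointApprox D a b → ∀ (D' : Literature.Probability.RandomPlanarGeometry.DobrushinDomain), (D'.carrier ⊆ D.carrier ∧ D'.pt 0 = D.pt 0 ∧ D'.pt 1 = D.pt 1 ∧ D.pt 0 ∉ closure (D.carrier \ D'.carrier) ∧ D.pt 1 ∉ closure (D.carrier \ D'.carrier)) → ∀ (φ : Literature.Probability.RandomPlanarGeometry.ConformalEquiv UpperHalfPlane.upperHalfPlaneSet D.carrier), D.IsChordalUniformizing φ → ∀ (Φ : Literature.Probability.RandomPlanarGeometry.ConformalEquiv (UpperHalfPlane.upperHalfPlaneSet \ closure (UpperHalfPlane.upperHalfPlaneSet \ {z : ℂ | z ∈ UpperHalfPlane.upperHalfPlaneSet ∧ φ z ∈ D'.carrier})) UpperHalfPlane.upperHalfPlaneSet)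 (d : ℝ), Literature.Probability.RandomPlanarGeometry.IsRestrictionMap (closure (UpperHalfPlane.upperHalfPlaneSet \ {z : ℂ | z ∈ UpperHalfPlane.upperHalfPlaneSet ∧ φ z ∈ D'.carrier})) Φ → Literature.Probability.RandomPlanarGeometry.HasRestrictionDeriv (closure (UpperHalfPlane.upperHalfPlaneSet \ {z : ℂ | z ∈ UpperHalfPlane.upperHalfPlaneSet ∧ φ z ∈ D'.carrier})) Φ d → Filter.Tendsto (fun δ => (∑' ω : (Literature.Probability.LatticeModels.discreteDomainGraph D.carrier δ).Walk (a δ) (b δ), Set.indicator {ω' : (Literature.Probability.LatticeModels.discreteDomainGraph D.carrier δ).Walk (a δ) (b δ) | Set.range (ω'.toCurve (Literature.Probability.LatticeModels.meshPoint δ)) ⊆ closure D'.carrier} (fun ω' => ((4 : ENNReal)⁻¹) ^ ω'.length) ω) / (∑' ω : (Literature.Probability.LatticeModels.discreteDomainGraph D.carrier δ).Walk (a δ) (b δ), ((4 : ENNReal)⁻¹) ^ ω.length)) (nhdsWithin 0 (Set.Ioi 0)) (nhds (ENNReal.ofReal d))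

-- earlier SimpleSubseqLimits (stmt-CriticalPhenomena-4536, replaced 2026-08-15T16:21:26Z -> stmt-CriticalPhenomena-4982): retired by None — ∀ (D : Literature.Probability.RandomPlanarGeometry.DobrushinDomain) (a b : ℝ → Literature.Probability.LatticeModels.Site 2), Literature.Probability.RandomPlanarGeometry.SAW.IsEndpointApprox D a b → ∀ (μ : MeasureTheory.Measure (Literature.Probability.RandomPlana
/-- item stmt-CriticalPhenomena-4982 · crux · rank 6 · open · by planner
why it might fail: Weak limits of simple polylines need not be simple (CurveClass.simple is not closed): needs δ-uniform no-macroscopic-self-touching and no-boundary-crawling bounds for x_c-SAW under EVERY endpoint approximation; only sub-ballisticity (arXiv:1205.0401) is in print.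
sources: LawlerSchrammWerner2004SAW, DuminilCopinHammond2013, KennedyLawler2013, stmt-CriticalPhenomena-4982, Summits/CriticalPhenomena/SAWScalingLimit/Ideas/brownian-domination-simple-limits.md
[crux] (S): for every Dobrushin domain, endpoint approximation, sequence s_n → 0+ and probability
measure ν on CurveClass ℂ that is the weak limit of the pushed-forward SAW laws along s_n, ν-a.e.
curve class is simple, runs from a = D.pt 0 to b = D.pt 1, has range in closure D and meets ∂D only
at a, b (exactly the carrier clause of AvoidanceDeterminesLaw). Subsequential form of
SAWConfRestriction.SimpleOfLimit (stmt-CriticalPhenomena-0774). Foreseen split: 'range is a simple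
boundary-avoiding arc' (follows from AvoidanceLimit + LSW Lemma 3.2 on filled ranges + SLE_(8/3)
simplicity) ∧ 'no retracing' (a near-self-approach estimate for x_c-SAW). [difficulty: open-problem] -/
@[route_item "route-CriticalPhenomena-SAWFrontierHomotopy", crux]
def SimpleSubseqLimits : Prop :=
  ∀ (D : Literature.Probability.RandomPlanarGeometry.DobrushinDomain) (a b : ℝ → Literature.Probability.LatticeModels.Site 2), Literature.Probability.RandomPlanarGeometry.SAW.IsEndpointApprox D a b → ∀ (s : ℕ → ℝ) (ν : MeasureTheory.Measure (Literature.Probability.RandomPlanarGeometry.CurveClass ℂ)), Filter.Tendsto s Filter.atTop (nhdsWithin 0 (Set.Ioi 0)) → MeasureTheory.IsProbabilityMeasure ν → (∀ f : BoundedContinuousFunction (Literature.Probability.RandomPlanarGeometry.CurveClass ℂ) ℝ, Filter.Tendsto (fun n => ∫ γ, f γ.curve ∂(Literature.Probability.RandomPlanarGeometry.SAW.law D.carrier (s n) (a (s n)) (b (s n)))) Filter.atTop (nhds (∫ x, f x ∂ν))) → ∀ᵐ γ ∂ν, γ ∈ Literature.Probability.RandomPlanarGeometry.CurveClass.simple ∧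 γ.source = D.pt 0 ∧ γ.target = D.pt 1 ∧ γ.range ⊆ closure D.carrier ∧ γ.range ∩ frontier D.carrier ⊆ {D.pt 0, D.pt 1}

-- item stmt-CriticalPhenomena-6843 · support · rank 5 · open · by planner — informal only, no Lean statement yet:
--   [crux] (card D2 — the ANCHOR THEOREM at curve level, route SAWFrontierHomotopy; informal until
--   definition requests RightFrontierSAW and SLEKappaRhoCurveLaw land) For every Dobrushin domain (D; a,
--   b) and endpoint approximation (SAW.IsEndpointApprox), the law of the checkerboard-pinch-filled RIGHT
--   FRONTIER (RightFrontierSAW: walk on the faces of D_δ, thickening = visited closed faces + pinch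
--   filling, frontier = a ℤ²-SAW = SAW.DomainSAW) of the simple-random-walk excursion a_δ → b_δ in D_δ
--   (walk weights ∝ 4^{-|ω|}), pushed to CurveClass ℂ by DomainSAW.curve, converges weakly as δ → 0⁺ to
--   the law

/-- item stmt-CriticalPhenomena-0783 · support · rank 9 · open · by planner
sources: LawlerSchrammWerner2004SAW, LawlerSchrammWerner2003Restriction, DuminilCopinSmirnov2012
[crux] r3: identification of subsequential limits — for every Dobrushin domain D, endpoint
approximation (a_δ,b_δ), sequence s_n → 0+ and probability measure μ on CurveClass ℂ, if ∫ f∘curve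
d(Literature.Probability.RandomPlanarGeometry.SAW.law D (s n) …) → ∫ f dμ for all bounded continuous
f then μ is the chordal SLE_{8/3} law in D (Literature.Probability.RandomPlanarGeometry.IsSLELaw
(8/3) D μ). Obtained from r2 (observable limit) by the martingale principle (LSW03
arXiv:math/0209343 Prop. 5.2: κ = 8/3 is singled out by the 5/8-observable), or from restriction
(sibling route). -/
@[route_item "route-CriticalPhenomena-SAWFrontierHomotopy"]
def SubseqIdentification : Prop :=
  ∀ (D : Literature.Probability.RandomPlanarGeometry.DobrushinDomain) (a b : ℝ → Literature.Probability.LatticeModels.Site 2), Literature.Probability.RandomPlanarGeometry.SAW.IsEndpointApprox D a b → ∀ (s : ℕ → ℝ) (μ : MeasureTheory.Measure (Literature.Probability.RandomPlanarGeometry.CurveClass ℂ)), Filter.Tendsto s Filter.atTop (nhdsWithin 0 (Set.Ioi 0)) → MeasureTheory.IsProbabilityMeasure μ → (∀ f : BoundedContinuousFunction (Literature.Probability.RandomPlanarGeometry.CurveClass ℂ) ℝ, Filter.Tendsto (fun n => ∫ γ, f γ.curve ∂(Literature.Probability.RandomPlanarGeometry.SAW.law D.carrier (s n) (a (s n)) (b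 (s n)))) Filter.atTop (nhds (∫ x, f x ∂μ))) → Literature.Probability.RandomPlanarGeometry.IsSLELaw ((8 : NNReal) / 3) D μ

-- earlier TightIdentificationGlue (stmt-CriticalPhenomena-10704, replaced 2026-08-15T16:54:56Z -> stmt-CriticalPhenomena-11216): retired by None — SubseqIdentification → EventualTight → SAWScalingLimit
-- earlier TightIdentificationGlue (stmt-CriticalPhenomena-4538, replaced 2026-08-15T16:21:26Z -> stmt-CriticalPhenomena-10704): proved by Summit.CriticalPhenomena.SAWScalingLimit.Theorems.frontierHomotopy_tightIdentificationGlue_proof @ cf29ad9b5131 — EventualTight → SubseqIdentification → SAWScalingLimit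
/-- item stmt-CriticalPhenomena-11216 · support · rank 9 · closed · proved by Summit.CriticalPhenomena.SAWScalingLimit.Theorems.frontierHomotopy_tightIdentificationGlue_proof @ cf29ad9b5131 (prover) · by planner
sources: Literature.Probability.RandomPlanarGeometry.convergesInLawToSLE_of_isTightAlongMesh, Literature.Probability.RandomPlanarGeometry.IsSLECurve.map_eq_holds, BillingsleyCPM1999
[support] the common tail of the SAW routes, RE-MATERIALISED 2026-08-15 by the route-repair seat:
SubseqIdentification → (T) → SAWScalingLimit, where the middle hypothesis (T) is EventualTight =
shared stmt-CriticalPhenomena-1372 WRITTEN OUT verbatim (∃ δ₀ > 0, IsTightMeasureSet of the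
pushed-forward SAW laws over δ ∈ (0, δ₀]) — inlined only because the gate renders support items in
item-id order, so this def precedes `EventualTight` in the file; `closes` feeds it `(h₄ :
EventualTight)` definitionally. (The rev-0 stmt-CriticalPhenomena-4538 `EventualTight →
SubseqIdentification → SAWScalingLimit` and the 16:21Z form stmt-CriticalPhenomena-10704 were
rendered BLOCKED: missing decl EventualTight.) Proof plan: for each (D, a, b) with IsEndpointApprox
the laws SAW.law are probability measures for all small δ (reachability ⇒ weight univ ≠ 0; finitely
many SAWs in bounded Ω_δ ⇒ < ∞), so replace them by a probability-valued family with the same germ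
at 0⁺ (ConvergesInLawToSLE and the subsequential-limit hypotheses only see the germ; the PROVED
criterion wants [∀ δ, IsProbabilityMeasure (P δ)] — clamp the family off the germ), get
IsTightAlongMesh from the ∃δ₀ tight-set form (refuter evide -/
@[route_item "route-CriticalPhenomena-SAWFrontierHomotopy", crux]
def TightIdentificationGlue : Prop :=
  SubseqIdentification → (∀ (D : Literature.Probability.RandomPlanarGeometry.DobrushinDomain) (a b : ℝ → Literature.Probability.LatticeModels.Site 2), Literature.Probability.RandomPlanarGeometry.SAW.IsEndpointApprox D a b → ∃ δ₀ : ℝ, 0 < δ₀ ∧ MeasureTheory.IsTightMeasureSet ((fun δ => (Literature.Probability.RandomPlanarGeometry.SAW.law D.carrier δ (a δ) (b δ)).map (fun γ => γ.curve)) '' Set.Ioc 0 δ₀)) → SAWScalingLimit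

/-- item stmt-CriticalPhenomena-1372 · support · rank 9 · open · by planner
why it might fail: Open for SAW: no RSW / annulus-crossing bound at x_c (KemppainenSmirnov2017 §4 covers FKG models only); the all-δ form stmt-CriticalPhenomena-0772 is refuted; only sub-ballisticity (DuminilCopinHammond2013) is unconditional.
sources: KemppainenSmirnov2017, AizenmanBurchardDuke1999, DuminilCopinHammond2013, Summit.CriticalPhenomena.SAWScalingLimit.Theorems.SAWParafermionTight_refuted
[support] eventual tightness of the pushed-forward critical SAW laws: for every Dobrushin domain and
endpoint approximation there is δ₀ > 0 such that {(law D δ a_δ b_δ).map curve : δ ∈ (0, δ₀]} is a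
tight set of measures on CurveClass ℂ — the repaired (∃ δ₀) form of the refuted all-δ statement
stmt-CriticalPhenomena-0772 suggested by its refutation; child-designate of LimitExists, shared need
of every SAW route. Intended tools: Aizenman–Burchard / Kemppainen–Smirnov Condition G2 (an
annulus-crossing bound at x_c not in print). Sources: KemppainenSmirnov2017 Thm 1.5,
AizenmanBurchardDuke1999, DuminilCopinHammond2013. -/
@[route_item "route-CriticalPhenomena-SAWFrontierHomotopy", crux]
def EventualTight : Prop :=
  ∀ (D : Literature.Probability.RandomPlanarGeometry.DobrushinDomain) (a b : ℝ → Literature.Probability.LatticeModels.Site 2), Literature.Probability.RandomPlanarGeometry.SAW.IsEndpointApprox D a b → ∃ δ₀ : ℝ, 0 < δ₀ ∧ MeasureTheory.IsTightMeasureSet ((fun δ => (Literature.Probability.RandomPlanarGeometry.SAW.law D.carrier δ (a δ) (b δ)).map (fun γ => γ.curve)) '' Set.Ioc 0 δ₀)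

/-- item stmt-CriticalPhenomena-1373 · support · rank 9 · closed · proved by Summit.CriticalPhenomena.SAWScalingLimit.Theorems.AvoidanceDeterminesLaw.AvoidanceDeterminesLaw_proof (prover) · by planner
sources: LawlerSchrammWerner2003Restriction, AizenmanBurchard1999
[support] avoidance determines the law: two probability measures on CurveClass ℂ carried by SIMPLE
chords of the Dobrushin domain D from a to b meeting ∂D only at a, b, which give the same mass to
{range ⊆ closure D'} for every Dobrushin D' ⊆ D with the same marked points and agreeing with D near
a and b (the form delivered by AvoidanceCocycleLimit), are equal (π-system of filled hull
complements generating the Borel sets of simple boundary-avoiding chords: a simple chord is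
determined by its range; Lusin–Souslin for γ ↦ range). Planar-topology/measure-theory analogue of
LSW03 §3 ('the law of K is determined by P[K ∩ A = ∅]'); used for uniqueness of subsequential SAW
limits and for uniqueness of the restriction extension to slit domains. Sources:
LawlerSchrammWerner2003Restriction §3, AizenmanBurchard1999 §2.1. -/
@[route_item "route-CriticalPhenomena-SAWFrontierHomotopy"]
def AvoidanceDeterminesLaw : Prop :=
  ∀ (D : Literature.Probability.RandomPlanarGeometry.DobrushinDomain) (μ ν : MeasureTheory.Measure (Literature.Probability.RandomPlanarGeometry.CurveClass ℂ)), MeasureTheory.IsProbabilityMeasure μ → MeasureTheory.IsProbabilityMeasure ν → (∀ᵐ γ ∂μ, γ ∈ Literature.Probability.RandomPlanarGeometry.CurveClass.simple ∧ γ.source = D.pt 0 ∧ γ.target = D.pt 1 ∧ γ.range ⊆ closure D.carrier ∧ γ.range ∩ frontier D.carrier ⊆ {D.pt 0, D.pt 1}) → (∀ᵐ γ ∂ν, γ ∈ Literature.Probability.RandomPlanarGeometry.CurveClass.simple ∧ γ.source = D.pt 0 ∧ γ.target = D.pt 1 ∧ γ.range ⊆ closure D.carrier ∧ γ.range ∩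 frontier D.carrier ⊆ {D.pt 0, D.pt 1}) → (∀ D' : Literature.Probability.RandomPlanarGeometry.DobrushinDomain, D'.carrier ⊆ D.carrier → D'.pt 0 = D.pt 0 → D'.pt 1 = D.pt 1 → (∃ ε : ℝ, 0 < ε ∧ D'.carrier ∩ Metric.ball (D.pt 0) ε = D.carrier ∩ Metric.ball (D.pt 0) ε ∧ D'.carrier ∩ Metric.ball (D.pt 1) ε = D.carrier ∩ Metric.ball (D.pt 1) ε) → μ (Literature.Probability.RandomPlanarGeometry.CurveClass.rangeSubset (closure D'.carrier)) = ν (Literature.Probability.RandomPlanarGeometry.CurveClass.rangeSubset (closure D'.carrier))) → μ = ν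

/-- `AvoidanceDeterminesLaw` holds: proved by `Summit.CriticalPhenomena.SAWScalingLimit.Theorems.AvoidanceDeterminesLaw.AvoidanceDeterminesLaw_proof`. -/
theorem AvoidanceDeterminesLaw_holds : AvoidanceDeterminesLaw := _root_.Summit.CriticalPhenomena.SAWScalingLimit.Theorems.AvoidanceDeterminesLaw.AvoidanceDeterminesLaw_proof

/-- item stmt-CriticalPhenomena-4537 · support · rank 9 · open · by planner
why it might fail: Only bookkeeping, but real: the lattice restriction identity must be run against the largest-component / closure conventions of discreteDomainGraph (sandwich needs IsEndpointApprox in perturbed subdomains), and the Jordan-complement hulls must generate the avoidance π-system.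
sources: LawlerSchrammWerner2003Restriction, LawlerSchrammWerner2004SAW, Literature.Probability.RandomPlanarGeometry.LawlerSchrammWerner2003_holds, Literature.Probability.RandomPlanarGeometry.IsSLELaw.hullRestriction_eightThirds_holds
[support] the SYMMETRIC CLOSING (card D3, continuum + limit bookkeeping): OneSidedPowerLaw →
SimpleSubseqLimits → SubseqIdentification. Sketch: (i) every A ∈ 𝒬* is a disjoint union A₊ ⊔ A₋ of a
plus- and a minus-hull (ℍ ∖ A simply connected forces each component of A to touch ℝ on one side of
0), and Φ_A = Φ_(Φ_A₊(A₋)) ∘ Φ_A₊; (ii) exact lattice restriction of the x_c-SAW (LSW04 §3.4.5),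
applied with ε-enlarged/shrunk hulls (sandwich; continuity of A ↦ Φ'_A(0), tree
HullExhaustion/HullKernelLimit) and OneSidedPowerLaw in the intermediate domain D ∖ A₊, gives lim_δ
P_δ[γ ⊆ cl D''] = Φ'_A₊(0)^α · Φ'_(Φ_A₊(A₋))(0)^α = Φ'_A(0)^α for EVERY hull subdomain D''; (iii)
portmanteau (upper bound on the closed event, lower bound through enlarged hulls) transfers these
values to any subsequential limit μ, simple by SimpleSubseqLimits; (iv) by AvoidanceDeterminesLaw
the conformal images of μ form a well-defined chordal, conformally covariant family with hull
restriction (the Φ' cocycle) carried by simple curves, so the PROVED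
Literature.Probability.RandomPlanarGeometry.LawlerSchrammWerner2003_holds gives IsSLELaw (8/3) D μ —
α = 5/8 is output. No conformal covariance of the SAW is assumed anywhe -/
@[route_item "route-CriticalPhenomena-SAWFrontierHomotopy", crux]
def OneSidedClosing : Prop :=
  OneSidedPowerLaw → SimpleSubseqLimits → SubseqIdentification

-- earlier Assembly (stmt-CriticalPhenomena-10705, replaced 2026-08-16T08:10:27Z -> stmt-CriticalPhenomena-15124): retired by None — EventualTight → OneSidedPowerLaw → SimpleSubseqLimits → OneSidedClosing → TightIdentificationGlue → SAWScalingLimit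
-- earlier Assembly (stmt-CriticalPhenomena-4539, replaced 2026-08-15T16:21:26Z -> stmt-CriticalPhenomena-10705): retired by None — OneSidedPowerLaw → SimpleSubseqLimits → OneSidedClosing → EventualTight → TightIdentificationGlue → SAWScalingLimit
/-- item stmt-CriticalPhenomena-15124 · assembly · rank 1 · open · by planner
sources: LawlerSchrammWerner2003Restriction, LawlerSchrammWerner2004SAW
[assembly] frame statement #1 of the thesis, X → Statement with X = (E0) ∧ (S) ∧ (T) curried:
OneSidedPowerLaw → SimpleSubseqLimits → EventualTight → SAWScalingLimit. RESTATED 2026-08-16 by the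
route-repair seat (ground-failed): the previous form (stmt-CriticalPhenomena-10705: EventualTight →
OneSidedPowerLaw → SimpleSubseqLimits → OneSidedClosing → TightIdentificationGlue → SAWScalingLimit)
took the two glue items as hypotheses and was a tautology, flagged ground.trivial (`intros; aesop`)
by the gate battery; this form lists only the three load-bearing items, is NOT closed by the battery
(planner Sketch.lean: `#h21_ground` flags [] with defaults and with exact? + 20 s budget) and
follows from the glue items by pure logic — `fun h₁ h₂ hT => hG (hC h₁ h₂) hT` with hC :
OneSidedClosing (stmt-CriticalPhenomena-4537, open) and hG : TightIdentificationGlue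
(stmt-CriticalPhenomena-11216, proved) — so it closes the moment OneSidedClosing lands. The deciding
theorem `closes` (D-0027 §2.1) is unchanged and does not use this item. [difficulty: M — that of
OneSidedClosing] -/
@[route_item "route-CriticalPhenomena-SAWFrontierHomotopy"]
def Assembly : Prop :=
  OneSidedPowerLaw → SimpleSubseqLimits → EventualTight → SAWScalingLimit

/-! D-0027 §2.1 — DECIDING THEOREM (planner-authored via `route open/edit --closes-file`; by planner-rbadge-CriticalPhenomena-SAWFrontierHo-44a8bcf0-g4-0 2026-08-15T16:54:56Z):
its hypotheses are this route's items and its conclusion the sub-problem Statement (glue_lint), and it elaborates with this file. -/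

@[closes "route-CriticalPhenomena-SAWFrontierHomotopy"] theorem closes (h₁ : OneSidedPowerLaw) (h₂ : SimpleSubseqLimits) (h₃ : OneSidedClosing)
    (h₄ : EventualTight) (h₅ : TightIdentificationGlue) : _root_.SAWScalingLimit :=
  h₅ (h₃ h₁ h₂) h₄

end Summit.CriticalPhenomena.SAWScalingLimit.Theses.SAWFrontierHomotopy
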